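import Literature.NumberTheory.GaloisRepresentations.IdeleSUnitsCohomology
import Literature.NumberTheory.GaloisRepresentations.IdeleSUnitsClassSequenceInflation
import Literature.NumberTheory.NumberFields.HilbertClassFieldIdelic
import Literature.NumberTheory.Automorphic.IdeleClassBaseChangeInjective
import Mathlib.RepresentationTheory.Homological.GroupCohomology.LongExactSequence
import HarnessLib

/-!
# `#H¹(Gal(E/F), 𝒪_{E,S}ˣ) ≤ h_F` for `E/F` unramified outside `S` (NSW (8.3.11)(ii) at a finite layer:
# `H¹(G, 𝒪_{E,S}ˣ)` is a subquotient of the `S`-ideal class group of `F`)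

Topic `NumberTheory/GaloisRepresentations`; namespace `Literature.NumberTheory.GaloisRepresentations.IdeleCohomology`.
THEOREMS ONLY (no definition, no named fact, no `sorry`, no instance; D-0026).  Brick B6a (F1a) of lane «TATE-EPC-TC» of
cell `bsd-eis` (crux `GoodLatticeBDPValue`, stmt-BirchSwinnertonDyer-19032; successor of lane «PT3-TC»): the uniform layer
bound which, fed to `Algebra/Homology/DiscreteRepLayerColimitBounded`, makes `H¹(U, E_S)` finite.

For a finite Galois extension `E/F` of number fields, `G = Gal(E/F)`, and a finite set `S` of finite places of `F`
containing the places ramified in `E`: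
* `epi_δ_sUnits_zero`: the connecting map `δ : H⁰(G, J_{E,S}Eˣ/Eˣ) → H¹(G, 𝒪_{E,S}ˣ)` of
  (A) `0 → 𝒪_{E,S}ˣ → J_{E,S} → J_{E,S}Eˣ/Eˣ → 0` is onto, because `H¹(G, J_{E,S}) = 0` (tree `isZero_H1_ideleSRep`);
* `exists_ideleBaseChange_classRepHom_eq`: `C_E^G` consists of classes of base-changed idèles of `F` (tree
  `epi_H0_map_classRepHom` — `H¹(G, Eˣ) = 0` — and `mem_invariants_ideleRep_iff` — `J_E^G = J_F`);
* **`finite_H1_sUnitsIdeleRep`, `natCard_H1_sUnitsIdeleRep_le`**: `H¹(G, 𝒪_{E,S}ˣ)` is finite of order at most the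
  class number `h_F = #Cl(𝒪_F)`: two invariant classes of `J_{E,S}Eˣ/Eˣ` whose lifts `x, x' ∈ J_F` have the same ideal
  class differ by the class of `con(a·u)`, `a ∈ Fˣ`, `u ∈ W₁ ≤ 𝕌_F` (tree `ker_ideleIdealClass`), i.e. by the image of
  the invariant `S`-idèle `con u`, on which `δ` vanishes.

## References
* J. Neukirch, A. Schmidt, K. Wingberg, *Cohomology of Number Fields*, 2nd ed. (2008), VIII §3 (8.3.11)(ii) and its
  proof (`H¹(G_S, E_S) ≅ Cl_S`). [NeukirchSchmidtWingberg2008]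
* J. Neukirch, *Algebraic Number Theory* (1999), Ch. VI §1 Prop. (1.9), (1.11) (`I_K/Kˣ·W₁ ≅ Cl_K`). [NeukirchANT1999]
* D. Harari, *Galois Cohomology and Class Field Theory* (2020), Lemma 15.39, Prop. 13.1. [Harari2020]
-/

noncomputable section

open NumberField IsDedekindDomain CategoryTheory CategoryTheory.Limits groupCohomology
open Literature.NumberTheory.Automorphic Literature.NumberTheory.NumberFields

namespace Literature.NumberTheory.GaloisRepresentations

namespace IdeleCohomology

open Literature.Algebra.Homology

/-! ## §0. Counting through a surjection and an invariant with finitely many values -/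

/-- If `π : A → H` is onto and a function `θ : A → T` to a finite type separates the fibres of `π`
(`θ a = θ b → π a = π b`), then `H` is finite with `#H ≤ #T`. [cite: NeukirchANT1999, Ch. VI §1 (1.11)] -/
theorem finite_and_natCard_le_of_surjective {A H T : Type*} [Finite T] (π : A → H) (hπ : Function.Surjective π)
    (θ : A → T) (h : ∀ a b, θ a = θ b → π a = π b) : Finite H ∧ Nat.card H ≤ Nat.card T := by
  classical
  choose lift hlift using fun t : Set.range θ => t.2
  let g : Set.range θ → H := fun t => π (lift t)
  have hg : Function.Surjective g := fun x => by
    obtain ⟨a, rfl⟩ := hπ x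
    exact ⟨⟨θ a, a, rfl⟩, h _ _ (hlift ⟨θ a, a, rfl⟩)⟩
  haveI : Finite H := Finite.of_surjective g hg
  exact ⟨inferInstance, (Nat.card_le_card_of_surjective g hg).trans
    (Nat.card_le_card_of_injective (Subtype.val : Set.range θ → T) Subtype.val_injective)⟩

variable {F E : Type} [Field F] [NumberField F] [Field E] [NumberField E] [Algebra F E]
variable (S : Finset (HeightOneSpectrum (𝓞 F)))

/-! ## §1. `δ : H⁰(G, J_{E,S}Eˣ/Eˣ) ↠ H¹(G, 𝒪_{E,S}ˣ)` -/

variable [IsGalois F E]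

/-- **`δ : H⁰(G, J_{E,S}Eˣ/Eˣ) → H¹(G, 𝒪_{E,S}ˣ)` is onto** for `S ⊇` the ramified places (`H¹(G, J_{E,S}) = 0`).
[cite: NeukirchSchmidtWingberg2008, VIII §3 (8.3.11) (proof)] [cite: Harari2020, Prop. 13.1 (b)] -/
theorem epi_δ_sUnits_zero (hS : ∀ v : HeightOneSpectrum (𝓞 F), v ∉ S → Algebra.IsUnramifiedIn (𝓞 E) v.asIdeal) :
    Epi (groupCohomology.δ (sUnitsShortComplex_shortExact (F := F) (E := E) S) 0 1 rfl) :=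
  epi_δ_of_isZero _ 0 (isZero_H1_ideleSRep S hS)

/-! ## §2. Invariant idèle classes are base changes -/

omit S in
/-- **`C_E^G ⊆ image of J_F`**: an invariant idèle class of `E` is the class of the base change of an idèle of `F`
(`H¹(G, Eˣ) = 0` and `J_E^G = J_F`). [cite: Harari2020, Prop. 13.1] [cite: NeukirchSchmidtWingberg2008, VIII §1] -/
theorem exists_ideleBaseChange_classRepHom_eq (c : (IdeleClassGroup.galoisRep F E).V)
    (hc : c ∈ (IdeleClassGroup.galoisRep F E).ρ.invariants) :
    ∃ x : ideleGroup F,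
      (IdeleClassGroup.classRepHom F E).hom (Additive.ofMul (AdeleRing.ideleBaseChange F E x)) = c := by
  have hsurj := (ModuleCat.epi_iff_surjective _).1 (IdeleClassGroup.epi_H0_map_classRepHom (F := F) (E := E))
  obtain ⟨y, hy⟩ := hsurj ((H0Iso (IdeleClassGroup.galoisRep F E)).inv ⟨c, hc⟩)
  change groupCohomology.map (MonoidHom.id _) (IdeleClassGroup.classRepHom F E) 0 y = _ at hy
  have e1 := groupCohomology.map_id_comp_H0Iso_hom_apply (IdeleClassGroup.classRepHom F E) y
  -- `⟨c, hc⟩ = (H0Iso C_E).hom (H⁰(classRepHom) y) = (invariantsFunctor ℤ G).map classRepHom ((H0Iso J_E).hom y)`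
  have e2 := ((Iso.inv_hom_id_apply (H0Iso (IdeleClassGroup.galoisRep F E)) ⟨c, hc⟩).symm.trans
    (congrArg (H0Iso (IdeleClassGroup.galoisRep F E)).hom hy.symm)).trans e1
  set z := (H0Iso (IdeleClassGroup.ideleRep F E)).hom y with hz
  obtain ⟨x, hx⟩ := (IdeleClassGroup.mem_invariants_ideleRep_iff (F := F) (E := E) z.1).1 z.2
  refine ⟨x, ?_⟩
  rw [hx]
  exact (congrArg Subtype.val e2).symm

/-! ## §3. The bound `#H¹(G, 𝒪_{E,S}ˣ) ≤ h_F` -/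

omit [IsGalois F E] in
/-- The class of `C_E` underlying `y ∈ H⁰(G, J_{E,S}Eˣ/Eˣ)` is `G`-invariant. [cite: NeukirchSchmidtWingberg2008, VIII §3 (8.3.9)] -/
theorem ideleSClassι_H0Iso_mem_invariants (y : groupCohomology (ideleSClassRep F E S) 0) :
    (ideleSClassι S).hom ((H0Iso (ideleSClassRep F E S)).hom y).1 ∈ (IdeleClassGroup.galoisRep F E).ρ.invariants :=
  fun g => by
    rw [← Rep.hom_comm_apply, ((H0Iso (ideleSClassRep F E S)).hom y).2 g]

/-- A base-changed `S`-idèle of `F` lying in `J_{E,S}` is a `G`-invariant vector of `J_{E,S}`.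
[cite: CasselsFrohlichANT1967, Ch. II §19] -/
theorem ideleSRep_ρ_ofMul_ideleBaseChange (g : E ≃ₐ[F] E) (u : ideleGroup F)
    (hu : AdeleRing.ideleBaseChange F E u ∈ ideleS F E S) :
    (ideleSRep F E S).ρ g (Additive.ofMul ⟨AdeleRing.ideleBaseChange F E u, hu⟩) =
      Additive.ofMul ⟨AdeleRing.ideleBaseChange F E u, hu⟩ := by
  have hinv : Additive.ofMul (AdeleRing.ideleBaseChange F E u) ∈ (IdeleClassGroup.ideleRep F E).ρ.invariants :=
    (IdeleClassGroup.mem_invariants_ideleRep_iff (F := F) (E := E) _).2 ⟨u, rfl⟩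
  apply ideleSRepHom_injective
  rw [Rep.hom_comm_apply]
  exact hinv g

/-- **`H¹(Gal(E/F), 𝒪_{E,S}ˣ)` is finite of order at most the class number `h_F`** for `S ⊇` the places ramified in
`E/F` (NSW (8.3.11)(ii) at a finite layer: `H¹ ≅ (J_{E,S}Eˣ/Eˣ)^G / J_{F,S}` injects into the `S`-ideal class group of
`F`, a quotient of `Cl(𝒪_F)`). [cite: NeukirchSchmidtWingberg2008, VIII §3 (8.3.11)(ii)] [cite: NeukirchANT1999, Ch. VI §1 (1.11)] -/
theorem finite_H1_sUnitsIdeleRep_and_natCard_le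
    (hS : ∀ v : HeightOneSpectrum (𝓞 F), v ∉ S → Algebra.IsUnramifiedIn (𝓞 E) v.asIdeal) :
    Finite (groupCohomology (sUnitsIdeleRep F E S) 1) ∧
      Nat.card (groupCohomology (sUnitsIdeleRep F E S) 1) ≤ Fintype.card (ClassGroup (𝓞 F)) := by
  classical
  -- the surjection `δ`
  have hA := sUnitsShortComplex_shortExact (F := F) (E := E) S
  let π : groupCohomology (ideleSClassRep F E S) 0 → groupCohomology (sUnitsIdeleRep F E S) 1 :=
    fun y => groupCohomology.δ hA 0 1 rfl y
  have hπ : Function.Surjective π := (ModuleCat.epi_iff_surjective _).1 (epi_δ_sUnits_zero S hS)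
  -- the lifts to `J_F` and the invariant `θ = ideal class of the lift`
  choose lift hlift using fun y : groupCohomology (ideleSClassRep F E S) 0 =>
    exists_ideleBaseChange_classRepHom_eq (F := F) (E := E) _ (ideleSClassι_H0Iso_mem_invariants S y)
  let θ : groupCohomology (ideleSClassRep F E S) 0 → ClassGroup (𝓞 F) := fun y => ideleIdealClass F (lift y)
  rw [← Nat.card_eq_fintype_card]
  refine finite_and_natCard_le_of_surjective π hπ θ fun y y' hyy' => ?_
  -- two lifts with the same ideal class differ by `a · u`, `a ∈ Fˣ`, `u ∈ W₁`
  have hq : (lift y)⁻¹ * lift y' ∈ (ideleIdealClass F).ker := by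
    rw [MonoidHom.mem_ker, map_mul, map_inv, show ideleIdealClass F (lift y) = ideleIdealClass F (lift y') from hyy',
      inv_mul_cancel]
  rw [hilbertClassField.ker_ideleIdealClass] at hq
  obtain ⟨a, ha, u, hu, hau⟩ := Subgroup.mem_sup.1 hq
  have huS : AdeleRing.ideleBaseChange F E u ∈ ideleS F E S :=
    ideleBaseChange_mem_ideleS (F := F) (E := F) (E' := E) S (unitIdeles_le_ideleS (rayUnitIdeles_le_unitIdeles hu))
  have haP : AdeleRing.ideleBaseChange F E a ∈ principalIdeles E := ideleBaseChange_mem_principalIdeles F E ha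
  -- the invariant `S`-idèle `con u` as an element of `H⁰(G, J_{E,S})`
  let wJ : (ideleSRep F E S).V := Additive.ofMul ⟨AdeleRing.ideleBaseChange F E u, huS⟩
  have hwJ : wJ ∈ (ideleSRep F E S).ρ.invariants := fun g => ideleSRep_ρ_ofMul_ideleBaseChange S g u huS
  let w : groupCohomology (ideleSRep F E S) 0 := (H0Iso (ideleSRep F E S)).inv ⟨wJ, hwJ⟩
  -- (1) in `C_E`: class(con x') = class(con x) + class(con u)
  have hC : (ideleSClassι S).hom ((H0Iso (ideleSClassRep F E S)).hom y').1 =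
      (ideleSClassι S).hom ((H0Iso (ideleSClassRep F E S)).hom y).1 +
        (IdeleClassGroup.classRepHom F E).hom (Additive.ofMul (AdeleRing.ideleBaseChange F E u)) := by
    rw [← hlift y, ← hlift y']
    have hx' : lift y' = a * (lift y * u) := by rw [mul_left_comm, hau, mul_inv_cancel_left]
    have ha0 : (IdeleClassGroup.classRepHom F E).hom (Additive.ofMul (AdeleRing.ideleBaseChange F E a)) = 0 := by
      rw [IdeleClassGroup.classRepHom_apply]
      exact congrArg Additive.ofMul ((QuotientGroup.eq_one_iff _).2 haP)
    rw [hx', map_mul, map_mul]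
    change (IdeleClassGroup.classRepHom F E).hom
        ((Additive.ofMul (AdeleRing.ideleBaseChange F E a) : Additive (ideleGroup E)) +
          ((Additive.ofMul (AdeleRing.ideleBaseChange F E (lift y)) : Additive (ideleGroup E)) +
            (Additive.ofMul (AdeleRing.ideleBaseChange F E u) : Additive (ideleGroup E)))) = _
    exact (map_add _ _ _).trans ((congrArg₂ (· + ·) ha0 (map_add _ _ _)).trans (zero_add _))
  -- (2) hence `y' = y + H⁰(g)(w)` in `H⁰(G, J_{E,S}Eˣ/Eˣ)`
  have hY : y' = y + groupCohomology.map (MonoidHom.id _) (ideleSToIdeleSClass (F := F) (E := E) S) 0 w := by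
    apply (H0Iso (ideleSClassRep F E S)).toLinearEquiv.injective
    change (H0Iso (ideleSClassRep F E S)).hom y' = (H0Iso (ideleSClassRep F E S)).hom (y + _)
    rw [map_add, groupCohomology.map_id_comp_H0Iso_hom_apply, Iso.inv_hom_id_apply]
    apply Subtype.ext
    apply ideleSClassι_injective S
    rw [hC, Submodule.coe_add, map_add]
    rfl
  -- (3) `δ` kills the image of `H⁰(G, J_{E,S})`
  have hδ : groupCohomology.δ hA 0 1 rfl
      (groupCohomology.map (MonoidHom.id _) (ideleSToIdeleSClass (F := F) (E := E) S) 0 w) = 0 := by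
    have h0 := congrArg ModuleCat.Hom.hom (groupCohomology.mapShortComplex₃ hA (i := 0) (j := 1) rfl).zero
    rw [ModuleCat.hom_comp, ModuleCat.hom_zero] at h0
    exact LinearMap.congr_fun h0 w
  show groupCohomology.δ hA 0 1 rfl y = groupCohomology.δ hA 0 1 rfl y'
  rw [hY]
  symm
  calc groupCohomology.δ hA 0 1 rfl
        (y + groupCohomology.map (MonoidHom.id _) (ideleSToIdeleSClass (F := F) (E := E) S) 0 w)
      = groupCohomology.δ hA 0 1 rfl y + groupCohomology.δ hA 0 1 rfl
          (groupCohomology.map (MonoidHom.id _) (ideleSToIdeleSClass (F := F) (E := E) S) 0 w) := map_add _ _ _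
    _ = groupCohomology.δ hA 0 1 rfl y := by rw [hδ, add_zero]

/-- **`H¹(Gal(E/F), 𝒪_{E,S}ˣ)` is finite** (`S ⊇` the ramified places). [cite: NeukirchSchmidtWingberg2008, VIII §3 (8.3.11)(ii)] -/
theorem finite_H1_sUnitsIdeleRep
    (hS : ∀ v : HeightOneSpectrum (𝓞 F), v ∉ S → Algebra.IsUnramifiedIn (𝓞 E) v.asIdeal) :
    Finite (groupCohomology (sUnitsIdeleRep F E S) 1) :=
  (finite_H1_sUnitsIdeleRep_and_natCard_le S hS).1

/-- **`#H¹(Gal(E/F), 𝒪_{E,S}ˣ) ≤ h_F`** (`S ⊇` the ramified places). [cite: NeukirchSchmidtWingberg2008, VIII §3 (8.3.11)(ii)]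
[cite: NeukirchANT1999, Ch. VI §1 (1.11)] -/
theorem natCard_H1_sUnitsIdeleRep_le
    (hS : ∀ v : HeightOneSpectrum (𝓞 F), v ∉ S → Algebra.IsUnramifiedIn (𝓞 E) v.asIdeal) :
    Nat.card (groupCohomology (sUnitsIdeleRep F E S) 1) ≤ Fintype.card (ClassGroup (𝓞 F)) :=
  (finite_H1_sUnitsIdeleRep_and_natCard_le S hS).2

end IdeleCohomology

end Literature.NumberTheory.GaloisRepresentations

end
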